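import Literature.AlgebraicGeometry.HodgeTheory.HodgeGenericPointsAlmostAll
import Literature.AlgebraicGeometry.HodgeTheory.HypersurfaceFamilyCoordinates
import HarnessLib

/-!
# Very general points are Hodge generic, almost everywhere IN AFFINE COORDINATES: the push-forward of the exceptional set under the
# coordinates of ANY morphism of the base to an affine space is Lebesgue-null (GAGA + the null-meagre genericity theorem)

Family `hodge`, layer `Literature/AlgebraicGeometry/HodgeTheory`. THEOREMS only (no definition, no named fact). Written by the prover seat
`hodge-nonav-19716-p2` (g12, cell `hodge-nonav`), programme «GENERIC-AE», companion of `HodgeGenericPointsAlmostAll`.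

`HodgeGenericPointsAlmostAll.exists_nullMeagre_isHodgeGenericPoint` produces, for a smooth projective family `f : 𝒳 ⟶ S` with
quasi-projective total space over a smooth quasi-projective base (smooth of relative dimension `d`), a MEAGRE set `MS ⊆ S(ℂ)` of
non-generic points whose image under every map `F : S(ℂ) → ℂ^T` (`#T = d`) DIFFERENTIABLE IN THE ALGEBRAIC CHARTS is Lebesgue-null.
The families of the cell (route A's Carlson–Toledo family, route B's `familyM`, route C's `Q8Family`) sit over OPEN SUBSETS OF AFFINE
SPACES, their coordinate map being the coordinates of a morphism `g : S ⟶ 𝔸^σ`. This file supplies the differentiability hypothesis ONCE for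
all such `g` (Serre, GAGA: regular functions are holomorphic) and the resulting one-line corollary:

* `differentiableOn_affineCoords_map_comp_algebraicChart_symm` — for every morphism `g : S ⟶ 𝔸^σ_ℂ` (`σ` finite) and every point `t₁`,
  `z ↦ (xᵢ(g((algebraicChart S d t₁)⁻¹ z)))ᵢ` is `ℂ`-differentiable on the target of the algebraic chart at `t₁`
  (`mdifferentiable_affineCoords_map_comp` on the analytification `id : S(ℂ) → S(ℂ)` of the algebraic atlas; the argument of route A's
  `CyclicUnitaryPowersCyclicSurfacePowersHodgeAlmostAll.differentiableOn_coeffChart_comp_algebraicChart_symm` and of route B's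
  `…SignThreefoldPowersHodgeAlmostAll.differentiableOn_coeffChart_comp_algebraicChart_symm_baseM`, for a general `g`);
* `exists_nullMeagre_isHodgeGenericPoint_affineCoords` — **consumer form**: for such a family and a morphism `g : S ⟶ 𝔸^σ_ℂ` with
  `#σ = d`, there is a MEAGRE `MS ⊆ S(ℂ)` with `volume ((fun t ↦ affineCoords (g t)) '' MS) = 0` in `ℂ^σ`, null in every algebraic chart,
  off which every point is Hodge generic; `exists_nullMeagre_algebraicMonodromyGroup_subset_mumfordTateGroup_affineCoords` — the same
  with `Mon_s ⊆ MT(Hᵏ(X_s))` (irreducible base).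

When `g` is an open immersion (the cell's families) the coordinate map is a topological embedding with open image, so the image of `MS` is
ALSO meagre in `ℂ^σ` (`Topology.IsInducing.isMeagre_image`) — left to the consumer, who knows `g`. Honest scope: unconditional
bookkeeping; the exceptional set is not shown countable-Zariski (Cattani–Deligne–Kaplan); nothing here says HC or any rung is proved.

## References

* [SerreGAGA1956] J.-P. Serre, Géométrie algébrique et géométrie analytique, §2 n°5 Prop. 2.
* [Deligne1972WeilK3] P. Deligne, La conjecture de Weil pour les surfaces K3, Invent. Math. 15 (1972), Prop. 7.5.
* [Mityagin2015] B. Mityagin, The zero set of a real analytic function, arXiv:1512.07276, Prop. 1.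
-/

noncomputable section

open scoped Manifold ContDiff Topology TensorProduct
open MeasureTheory Set Module
open CategoryTheory AlgebraicGeometry
open _root_.Topology _root_.Filter
open Literature.AlgebraicTopology.SingularHomology
open Literature.AlgebraicGeometry.Motives Literature.NumberTheory.Transcendental

namespace Literature.AlgebraicGeometry.HodgeTheory

section HodgeTheory

/-! ### GAGA: affine coordinates of a morphism are holomorphic in algebraic charts -/

/-- **The affine coordinates of a morphism `g : S ⟶ 𝔸^σ_ℂ` are holomorphic in every algebraic chart of `S(ℂ)`** (Serre, GAGA §2 n°5:
regular functions are holomorphic): for every point `t₁`, `z ↦ (xᵢ(g((algebraicChart S d t₁)⁻¹ z)))ᵢ` is `ℂ`-differentiable on the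
target of the algebraic chart at `t₁` (`mdifferentiable_affineCoords_map_comp` on the analytification `id : S(ℂ) → S(ℂ)`, read in the
chart at `t₁`). [cite: SerreGAGA1956, §2 n°5 Prop. 2] -/
theorem differentiableOn_affineCoords_map_comp_algebraicChart_symm {S : SchemeOver ℂ} {σ : Type} [Fintype σ]
    (g : S ⟶ affineSpaceOver σ ℂ) (d : ℕ)
    [AlgebraicGeometry.LocallyOfFiniteType S.hom] [AlgebraicGeometry.SmoothOfRelativeDimension d S.hom]
    (t₁ : ComplexPoints S) :
    DifferentiableOn ℂ (fun z ↦ AlgPoints.affineCoords (AlgPoints.map g ((ComplexPoints.algebraicChart S d t₁).symm z)))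
      (ComplexPoints.algebraicChart S d t₁).target := by
  letI cs : ChartedSpace (Fin d → ℂ) (ComplexPoints S) :=
    chartedSpaceOfCharts (ComplexPoints.algebraicChart S d) (ComplexPoints.mem_algebraicChart_source _ d)
  haveI : IsManifold 𝓘(ℂ, Fin d → ℂ) ω (ComplexPoints S) := isManifold_algebraicChart _ d
  refine differentiableOn_pi.2 fun i ↦ ?_
  -- holomorphy on the manifold `S(ℂ)` (GAGA), read in the chart at `t₁`
  have hmd : MDifferentiable 𝓘(ℂ, Fin d → ℂ) 𝓘(ℂ, ℂ)
      (fun t : ComplexPoints S ↦ AlgPoints.affineCoords (AlgPoints.map g (id t)) i) :=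
    mdifferentiable_affineCoords_map_comp g (isAnalytification_algebraicChart (X := S) (e := d)) i
  intro z hz
  set c := ComplexPoints.algebraicChart S d t₁ with hc
  have hx' : c.symm z ∈ (chartAt (Fin d → ℂ) t₁).source := c.map_target hz
  have h := (mdifferentiableAt_iff_of_mem_source (I := 𝓘(ℂ, Fin d → ℂ)) (I' := 𝓘(ℂ, ℂ))
    (x := t₁) (y := AlgPoints.affineCoords (AlgPoints.map g (id (c.symm z))) i) hx'
    (mem_chart_source ℂ _)).1 (hmd (c.symm z))
  obtain ⟨-, hd⟩ := h
  rw [extChartAt_self_eq, modelWithCornersSelf_coe, Function.id_comp, ModelWithCorners.range_eq_univ] at hd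
  have hz' : extChartAt 𝓘(ℂ, Fin d → ℂ) t₁ (c.symm z) = z := by
    rw [extChartAt_coe, modelWithCornersSelf_coe, Function.id_comp]
    exact c.right_inv hz
  rw [hz'] at hd
  have hd' : DifferentiableAt ℂ (fun w ↦ AlgPoints.affineCoords (AlgPoints.map g (c.symm w)) i) z := by
    have := hd.differentiableAt Filter.univ_mem
    refine this.congr_of_eventuallyEq (Filter.Eventually.of_forall fun w ↦ ?_)
    simp only [Function.comp_apply, id_eq, extChartAt_coe_symm, modelWithCornersSelf_coe_symm, Function.comp_id]
    rfl
  exact hd'.differentiableWithinAt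

/-! ### The exceptional set is null in affine coordinates -/

/-- **Very general points are Hodge generic, almost everywhere in affine coordinates — UNCONDITIONAL.**  For a smooth projective family
`f : 𝒳 ⟶ S` of relative dimension `n` with `𝒳` quasi-projective over a smooth quasi-projective base `S` (smooth of relative dimension `d`),
Hodge-symmetric models `A`, a degree `k`, and ANY morphism `g : S ⟶ 𝔸^σ_ℂ` with `#σ = d` (e.g. the inclusion of an open of `𝔸^σ`): there is
a MEAGRE `MS ⊆ S(ℂ)`, null in every algebraic chart, with `volume ((fun t ↦ affineCoords (g t)) '' MS) = 0` in `ℂ^σ`, such that every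
point off `MS` is Hodge generic (`exists_nullMeagre_isHodgeGenericPoint` + `differentiableOn_affineCoords_map_comp_algebraicChart_symm`).
[cite: Deligne1972WeilK3, Prop. 7.5] [cite: SerreGAGA1956, §2 n°5 Prop. 2] [cite: Mityagin2015, Proposition 1] -/
theorem exists_nullMeagre_isHodgeGenericPoint_affineCoords
    [HodgeTensorFacts.{0, 0}] {𝒳 S : SchemeOver ℂ} (f : 𝒳 ⟶ S) (n k d : ℕ)
    (hf : IsSmoothProjectiveFamily f n) (hS : IsQuasiProjectiveOver S) (h𝒳 : IsQuasiProjectiveOver 𝒳)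
    [AlgebraicGeometry.LocallyOfFiniteType S.hom] [AlgebraicGeometry.SmoothOfRelativeDimension d S.hom]
    (hU : IsCohomologicallyLocallyTrivialOn f (Set.univ : Set (ComplexPoints S)))
    (A : ∀ t : ComplexPoints S, HodgeModel n (fiberOver f t)) (hA : ∀ t, (A t).IsHodgeSymmetric)
    [∀ t, Module.Finite ℚ (singularCohomology ℚ ℚ (ComplexPoints (fiberOver f t)) k)]
    {σ : Type} [Fintype σ] (hσ : Fintype.card σ = d) (g : S ⟶ affineSpaceOver σ ℂ) :
    ∃ MS : Set (ComplexPoints S), IsMeagre MS ∧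
      volume ((fun t : ComplexPoints S ↦ AlgPoints.affineCoords (AlgPoints.map g t)) '' MS) = 0 ∧
      (∀ t₁ : ComplexPoints S,
        volume (ComplexPoints.algebraicChart S d t₁ '' (MS ∩ (ComplexPoints.algebraicChart S d t₁).source)) = 0) ∧
      ∀ s : (Set.univ : Set (ComplexPoints S)), s.1 ∉ MS → IsHodgeGenericPoint f k hU hf A hA s := by
  obtain ⟨MS, hMS, hnull, hchart, hgen⟩ := exists_nullMeagre_isHodgeGenericPoint f n k d hf hS h𝒳 hU A hA
  exact ⟨MS, hMS, hnull σ hσ _ fun t₁ ↦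
      (differentiableOn_affineCoords_map_comp_algebraicChart_symm g d t₁).restrictScalars ℝ, hchart, hgen⟩

/-- **Off a MEAGRE set which is null in affine coordinates, the algebraic monodromy group lies in the Mumford–Tate group —
UNCONDITIONAL** (irreducible base; same `MS`; Deligne (i) PROVED). [cite: Deligne1972WeilK3, Prop. 7.5]
[cite: CarlsonMullerStachPeters2017, Lemma–Definition 15.3.7] [cite: SerreGAGA1956, §2 n°5 Prop. 2] -/
theorem exists_nullMeagre_algebraicMonodromyGroup_subset_mumfordTateGroup_affineCoords
    [HodgeTensorFacts.{0, 0}] {𝒳 S : SchemeOver ℂ} (f : 𝒳 ⟶ S) (n k d : ℕ)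
    (hf : IsSmoothProjectiveFamily f n) (hS : IsQuasiProjectiveOver S) (h𝒳 : IsQuasiProjectiveOver 𝒳)
    [AlgebraicGeometry.LocallyOfFiniteType S.hom] [AlgebraicGeometry.SmoothOfRelativeDimension d S.hom]
    (hirr : IrreducibleSpace S.left)
    (hU : IsCohomologicallyLocallyTrivialOn f (Set.univ : Set (ComplexPoints S)))
    (A : ∀ t : ComplexPoints S, HodgeModel n (fiberOver f t)) (hA : ∀ t, (A t).IsHodgeSymmetric)
    [∀ t, Module.Finite ℚ (singularCohomology ℚ ℚ (ComplexPoints (fiberOver f t)) k)]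
    {σ : Type} [Fintype σ] (hσ : Fintype.card σ = d) (g : S ⟶ affineSpaceOver σ ℂ) :
    ∃ MS : Set (ComplexPoints S), IsMeagre MS ∧
      volume ((fun t : ComplexPoints S ↦ AlgPoints.affineCoords (AlgPoints.map g t)) '' MS) = 0 ∧
      (∀ t₁ : ComplexPoints S,
        volume (ComplexPoints.algebraicChart S d t₁ '' (MS ∩ (ComplexPoints.algebraicChart S d t₁).source)) = 0) ∧
      ∀ s : (Set.univ : Set (ComplexPoints S)), s.1 ∉ MS →
        glIdentityComponent (ratMonodromyGroup f k hU s) ⊆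
          ((A s.1).hodgeStructure (hf.isSmoothProjective s.1) (hA s.1) k).mumfordTateGroup := by
  obtain ⟨MS, hMS, hnull, hchart, hgen⟩ :=
    exists_nullMeagre_algebraicMonodromyGroup_subset_mumfordTateGroup f n k d hf hS h𝒳 hirr hU A hA
  exact ⟨MS, hMS, hnull σ hσ _ fun t₁ ↦
      (differentiableOn_affineCoords_map_comp_algebraicChart_symm g d t₁).restrictScalars ℝ, hchart,
    fun s hs ↦ (hgen s hs).2⟩

end HodgeTheory

end Literature.AlgebraicGeometry.HodgeTheory

end
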